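import Mathlib
import HarnessLib
import Literature.MathematicalPhysics.KineticTheory.FouriersLaw
import Literature.MathematicalPhysics.KineticTheory.PhaseSpacePoisson
import Literature.MathematicalPhysics.KineticTheory.LangevinChainSDE
import Literature.Barriers.AtomisticToContinuum.MazurBoundBallisticOpenChain
import Literature.Barriers.AtomisticToContinuum.SpectralGapClosingEquilibrium

/-!
# First lemma of crux idea `gamblers-ruin-defect` (crux `ConeScaleCorrector`, ideator 1) — PROOF

`L E_L = w_L − J_tot/(N−1)` for the pinned chain, `N ≥ 2`, where `E_L = Σ_k (1 − k/(N−1)) e_k` is the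
left-exit-weighted energy (gambler's-ruin / harmonic-measure weight), `w_L = γ(T − p_0²)` the left bath
power and `J_tot = Σ_i j_i`.  Route: `E_L = H − X/(N−1)` (`X = energyMoment`), `L = {H, ·} + taps`,
`{H, H} = 0`, `{H, X} = J` (tree), taps of `H` and `X` explicit.
-/

namespace Summit.AtomisticToContinuum.FouriersLaw.Cruxes.ConeScaleCorrector.IdeatorOne

open scoped BigOperators
open Literature.MathematicalPhysics.KineticTheory.HeatConduction
open Literature.MathematicalPhysics.KineticTheory.HeatConduction.OscillatorChain
open Literature.Barriers.AtomisticToContinuum.OpenChain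

noncomputable section

variable {N : ℕ}

/-- Site energy (bond energies split evenly) — same text as `Sketch.lean`. -/
def siteEnergy (P : OscillatorChain) (N : ℕ) (k : Fin N) (x : PhaseSpace N) : ℝ :=
  x.2 k ^ 2 / 2 + P.U (x.1 k)
    + (1 / 2) * ∑ l : Fin N, (if l.val = k.val + 1 then P.V (x.1 l - x.1 k) else 0)
    + (1 / 2) * ∑ l : Fin N, (if k.val = l.val + 1 then P.V (x.1 k - x.1 l) else 0)

/-- Gambler's-ruin weight `s(k) = 1 − k/(N−1)`. -/
def leftShare (N : ℕ) (k : Fin N) : ℝ := 1 - (k.val : ℝ) / ((N : ℝ) - 1)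

/-- `E_L = Σ_k s(k) e_k`. -/
def leftWeightedEnergy (P : OscillatorChain) (N : ℕ) (x : PhaseSpace N) : ℝ :=
  ∑ k : Fin N, leftShare N k * siteEnergy P N k x

/-- `w_L = γ (T − p_0²)` as a sum over `i = 0`. -/
def bathPowerLeft (P : OscillatorChain) (N : ℕ) (T : ℝ) (x : PhaseSpace N) : ℝ :=
  ∑ i : Fin N, (if i.val = 0 then P.γ * (T - x.2 i ^ 2) else 0)

/-- `J_tot`. -/
def Jtot (P : OscillatorChain) (N : ℕ) (z : PhaseSpace N) : ℝ := ∑ i : Fin N, P.bondCurrent N i z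

/-! ## Step 1: weighted site energies as `Σ w_k (p_k²/2 + U) + Σ_{l = k+1} ½(w_k + w_l) V` -/

theorem sum_weight_siteEnergy (P : OscillatorChain) (w : Fin N → ℝ) (x : PhaseSpace N) :
    ∑ k : Fin N, w k * siteEnergy P N k x =
      (∑ k : Fin N, w k * (x.2 k ^ 2 / 2 + P.U (x.1 k))) +
        ∑ k : Fin N, ∑ l : Fin N,
          (if l.val = k.val + 1 then (w k + w l) / 2 * P.V (x.1 l - x.1 k) else 0) := by
  -- split e_k into its three parts
  have hsplit : ∀ k : Fin N, w k * siteEnergy P N k x =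
      w k * (x.2 k ^ 2 / 2 + P.U (x.1 k)) +
        (∑ l : Fin N, (if l.val = k.val + 1 then w k / 2 * P.V (x.1 l - x.1 k) else 0)) +
        (∑ l : Fin N, (if k.val = l.val + 1 then w k / 2 * P.V (x.1 k - x.1 l) else 0)) := by
    intro k
    simp only [siteEnergy, mul_add, Finset.mul_sum]
    congr 1
    · congr 1
      refine Finset.sum_congr rfl fun l _ => ?_
      split_ifs <;> ring
    · refine Finset.sum_congr rfl fun l _ => ?_
      split_ifs <;> ring
  rw [Finset.sum_congr rfl fun k _ => hsplit k, Finset.sum_add_distrib, Finset.sum_add_distrib]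
  -- reindex the third double sum: Σ_k Σ_l [k = l+1] w_k/2 V(q_k - q_l) = Σ_k Σ_l [l = k+1] w_l/2 V(q_l - q_k)
  have hcomm : ∑ k : Fin N, ∑ l : Fin N, (if k.val = l.val + 1 then w k / 2 * P.V (x.1 k - x.1 l) else 0) =
      ∑ k : Fin N, ∑ l : Fin N, (if l.val = k.val + 1 then w l / 2 * P.V (x.1 l - x.1 k) else 0) := by
    rw [Finset.sum_comm]
  rw [hcomm, add_assoc, ← Finset.sum_add_distrib]
  congr 1
  refine Finset.sum_congr rfl fun k _ => ?_
  rw [← Finset.sum_add_distrib]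
  refine Finset.sum_congr rfl fun l _ => ?_
  split_ifs <;> ring

/-- `Σ_k e_k = H`. -/
theorem sum_siteEnergy_eq_hamiltonian (P : OscillatorChain) (x : PhaseSpace N) :
    ∑ k : Fin N, siteEnergy P N k x = P.hamiltonian N x := by
  have h := sum_weight_siteEnergy P (fun _ => (1 : ℝ)) x
  simp only [one_mul] at h
  rw [h]
  unfold OscillatorChain.hamiltonian
  congr 1
  refine Finset.sum_congr rfl fun k _ => Finset.sum_congr rfl fun l _ => ?_
  split_ifs <;> ring

/-- `Σ_k k·e_k = X` (`energyMoment`). -/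
theorem sum_mul_siteEnergy_eq_energyMoment (P : OscillatorChain) (x : PhaseSpace N) :
    ∑ k : Fin N, (k.val : ℝ) * siteEnergy P N k x = energyMoment P N x := by
  rw [sum_weight_siteEnergy P (fun k => (k.val : ℝ)) x]
  unfold energyMoment
  congr 1
  refine Finset.sum_congr rfl fun k _ => Finset.sum_congr rfl fun l _ => ?_
  split_ifs with h
  · have hl : (l.val : ℝ) = (k.val : ℝ) + 1 := by exact_mod_cast h
    rw [hl]; ring
  · rfl

/-- `E_L = H − X/(N−1)` pointwise. -/
theorem leftWeightedEnergy_eq (P : OscillatorChain) (N : ℕ) :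
    leftWeightedEnergy P N = fun x => P.hamiltonian N x + (-(1 / ((N : ℝ) - 1))) * energyMoment P N x := by
  funext x
  unfold leftWeightedEnergy leftShare
  have h1 := sum_siteEnergy_eq_hamiltonian P x
  have h2 := sum_mul_siteEnergy_eq_energyMoment P x
  rw [← h1, ← h2, Finset.mul_sum, ← Finset.sum_add_distrib]
  refine Finset.sum_congr rfl fun k _ => ?_
  ring

/-! ## Step 2: regularity -/

theorem contDiff_energyMoment (P : OscillatorChain) {n : WithTop ℕ∞} (hU : ContDiff ℝ n P.U)
    (hV : ContDiff ℝ n P.V) (N : ℕ) : ContDiff ℝ n (energyMoment P N) := by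
  unfold energyMoment
  have hq : ∀ i : Fin N, ContDiff ℝ n fun x : PhaseSpace N => x.1 i := fun i =>
    (contDiff_apply ℝ ℝ i).comp contDiff_fst
  have hp : ∀ i : Fin N, ContDiff ℝ n fun x : PhaseSpace N => x.2 i := fun i =>
    (contDiff_apply ℝ ℝ i).comp contDiff_snd
  apply ContDiff.add
  · exact ContDiff.sum fun i _ => contDiff_const.mul ((((hp i).pow 2).div_const 2).add (hU.comp (hq i)))
  · refine ContDiff.sum fun i _ => ContDiff.sum fun j _ => ?_
    by_cases h : j.val = i.val + 1
    · simp only [h, if_true]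
      exact contDiff_const.mul (hV.comp ((hq j).sub (hq i)))
    · simp only [h, if_false]
      exact contDiff_const

/-! ## Step 3: the generator as `{H, ·}` plus the two taps -/

theorem generator_eq_poisson_add_taps (P : OscillatorChain) (N : ℕ) (T_L T_R : ℝ)
    (f : PhaseSpace N → ℝ) (x : PhaseSpace N) :
    P.generator N T_L T_R f x = poisson (P.hamiltonian N) f x +
      P.γ * ∑ i : Fin N,
        ((if i.val = 0 then T_L * partialP i (partialP i f) x - x.2 i * partialP i f x else 0) +
          (if i.val = N - 1 then T_R * partialP i (partialP i f) x - x.2 i * partialP i f x else 0)) := by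
  unfold OscillatorChain.generator poisson
  simp only [partialP_hamiltonian]

/-- `∂_{p_i} (p_i) = 1`. -/
theorem partialP_snd_self (i : Fin N) (c : ℝ) (x : PhaseSpace N) :
    partialP i (fun y : PhaseSpace N => c * y.2 i) x = c := by
  unfold partialP
  simp only [Function.update_self]
  rw [deriv_const_mul_field, deriv_id'', mul_one]

/-! ## Step 4: the first lemma -/

/-- **First lemma of card `gamblers-ruin-defect`**: `L E_L = w_L − J_tot/(N−1)` for `pinnedChain`, `N ≥ 2`. -/
theorem generator_leftWeightedEnergy (ω₂ lam β γ T : ℝ) (hN : 2 ≤ N) (x : PhaseSpace N) :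
    (pinnedChain ω₂ lam β γ).generator N T T (leftWeightedEnergy (pinnedChain ω₂ lam β γ) N) x =
      bathPowerLeft (pinnedChain ω₂ lam β γ) N T x
        - (1 / ((N : ℝ) - 1)) * Jtot (pinnedChain ω₂ lam β γ) N x := by
  set P := pinnedChain ω₂ lam β γ with hP
  set c : ℝ := 1 / ((N : ℝ) - 1) with hc
  have hU : ContDiff ℝ (⊤ : WithTop ℕ∞) P.U := pinnedChain_contDiff_U ω₂ lam β γ
  have hV : ContDiff ℝ (⊤ : WithTop ℕ∞) P.V := pinnedChain_contDiff_V ω₂ lam β γ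
  have hHs : ContDiff ℝ (⊤ : WithTop ℕ∞) (P.hamiltonian N) := P.contDiff_hamiltonian hU hV N
  have hXs : ContDiff ℝ (⊤ : WithTop ℕ∞) (energyMoment P N) := contDiff_energyMoment P hU hV N
  have hH : Differentiable ℝ (P.hamiltonian N) := hHs.differentiable (by simp)
  have hX : Differentiable ℝ (energyMoment P N) := hXs.differentiable (by simp)
  have hUd : Differentiable ℝ P.U := hU.differentiable (by simp)
  have hVd : Differentiable ℝ P.V := hV.differentiable (by simp)
  have hcX : Differentiable ℝ (fun y : PhaseSpace N => (-c) * energyMoment P N y) := hX.const_mul _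
  -- E_L = H + (-c) X
  have hE : leftWeightedEnergy P N = (P.hamiltonian N) + fun y => (-c) * energyMoment P N y := by
    rw [leftWeightedEnergy_eq]; rfl
  -- first p-derivatives of E_L
  have hd1 : ∀ i : Fin N, partialP i (leftWeightedEnergy P N) =
      fun y : PhaseSpace N => (1 + (-c) * (i.val : ℝ)) * y.2 i := by
    intro i; funext y
    rw [hE, partialP_add hH hcX, partialP_const_mul, partialP_hamiltonian, partialP_energyMoment]
    ring
  -- second p-derivatives of E_L
  have hd2 : ∀ i : Fin N, ∀ y : PhaseSpace N,
      partialP i (partialP i (leftWeightedEnergy P N)) y = 1 + (-c) * (i.val : ℝ) := by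
    intro i y
    rw [hd1 i, partialP_snd_self]
  -- Poisson part: {H, E_L} = {H,H} + (-c){H,X} = -c J
  have hpois : poisson (P.hamiltonian N) (leftWeightedEnergy P N) x = (-c) * Jtot P N x := by
    rw [hE, poisson_add_right _ hH hcX, poisson_self, poisson_const_mul_right,
      ← sum_bondCurrent_eq_poisson P hUd hVd N x]
    simp [Jtot]
  rw [generator_eq_poisson_add_taps, hpois]
  -- taps
  have htap : ∀ i : Fin N,
      ((if i.val = 0 then T * partialP i (partialP i (leftWeightedEnergy P N)) x -
            x.2 i * partialP i (leftWeightedEnergy P N) x else 0) +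
        (if i.val = N - 1 then T * partialP i (partialP i (leftWeightedEnergy P N)) x -
            x.2 i * partialP i (leftWeightedEnergy P N) x else 0)) =
      (if i.val = 0 then (T - x.2 i ^ 2) else 0) := by
    intro i
    rw [hd2 i, hd1 i]
    have hN1 : ((N : ℝ) - 1) ≠ 0 := by
      have : (2 : ℝ) ≤ N := by exact_mod_cast hN
      linarith
    by_cases h0 : i.val = 0
    · have hne : i.val ≠ N - 1 := by omega
      rw [if_pos h0, if_neg hne, if_pos h0]
      have hcast0 : ((i.val : ℕ) : ℝ) = 0 := by rw [h0]; simp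
      rw [hcast0]
      ring
    · rw [if_neg h0, if_neg h0, zero_add]
      by_cases h1 : i.val = N - 1
      · rw [if_pos h1]
        have hcast : ((i.val : ℕ) : ℝ) = (N : ℝ) - 1 := by
          rw [h1, Nat.cast_sub (by omega)]; simp
        have hzero : 1 + (-c) * (i.val : ℝ) = 0 := by
          rw [hcast, hc]; field_simp; ring
        rw [hzero]; ring
      · rw [if_neg h1]
  rw [Finset.sum_congr rfl fun i _ => htap i]
  -- assemble
  have hγ : P.γ = γ := rfl
  unfold bathPowerLeft
  rw [Finset.mul_sum]
  have : ∑ i : Fin N, P.γ * (if i.val = 0 then T - x.2 i ^ 2 else 0) =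
      ∑ i : Fin N, (if i.val = 0 then P.γ * (T - x.2 i ^ 2) else 0) := by
    refine Finset.sum_congr rfl fun i _ => ?_
    split_ifs <;> ring
  rw [this, hc]
  ring

end

end Summit.AtomisticToContinuum.FouriersLaw.Cruxes.ConeScaleCorrector.IdeatorOne

namespace Summit.AtomisticToContinuum.FouriersLaw.Cruxes.ConeScaleCorrector.IdeatorOne

open Literature.MathematicalPhysics.KineticTheory.HeatConduction

/-- The first-lemma `Prop` of `Sketch.lean` (same text). -/
def GeneratorOfLeftWeightedEnergy : Prop :=
  ∀ ω₂ lam β γ T : ℝ, ∀ N : ℕ, 2 ≤ N → ∀ x : PhaseSpace N,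
    (pinnedChain ω₂ lam β γ).generator N T T (leftWeightedEnergy (pinnedChain ω₂ lam β γ) N) x =
      bathPowerLeft (pinnedChain ω₂ lam β γ) N T x
        - (1 / ((N : ℝ) - 1)) * Jtot (pinnedChain ω₂ lam β γ) N x

/-- **PROVED**: the first lemma of card `gamblers-ruin-defect` holds. -/
theorem generatorOfLeftWeightedEnergy_holds : GeneratorOfLeftWeightedEnergy :=
  fun ω₂ lam β γ T _N hN x => generator_leftWeightedEnergy ω₂ lam β γ T hN x

end Summit.AtomisticToContinuum.FouriersLaw.Cruxes.ConeScaleCorrector.IdeatorOne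

/-! ## Appendix: the gambler's-ruin weights sum to zero over the bonds (`Σ_i u_i^{LE} = 0`, coefficientwise)

For each site `k ≤ N-1` the coefficient of `ẽ_k` in `Σ_{bonds i = 0}^{N-2} u_i^{LE}` is
`Σ_{i=0}^{N-2} (k/(N-1) − [k > i]) = (N−1)·k/(N−1) − #{i < k, i ≤ N-2} = k − k = 0`. -/

namespace Summit.AtomisticToContinuum.FouriersLaw.Cruxes.ConeScaleCorrector.IdeatorOne

/-- Coefficient of `ẽ_k` in the bond-sum of the gambler's-ruin forecasts: zero, for every site `k < N`
(bonds are `i = 0, …, N-2`, written as `Finset.range (N-1)`). -/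
theorem sum_ruinWeight_eq_zero {N : ℕ} (hN : 2 ≤ N) {k : ℕ} (hk : k < N) :
    ∑ i ∈ Finset.range (N - 1), ((k : ℝ) / ((N : ℝ) - 1) - if k > i then 1 else 0) = 0 := by
  rw [Finset.sum_sub_distrib, Finset.sum_const, Finset.card_range]
  have hN1 : ((N - 1 : ℕ) : ℝ) = (N : ℝ) - 1 := by
    rw [Nat.cast_sub (by omega)]; simp
  have hne : (N : ℝ) - 1 ≠ 0 := by
    have : (2 : ℝ) ≤ N := by exact_mod_cast hN
    linarith
  -- the indicator sum counts `#{i < N-1 : i < k} = k` (since `k ≤ N-1`)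
  have hcount : ∑ i ∈ Finset.range (N - 1), (if k > i then (1 : ℝ) else 0) = k := by
    rw [Finset.sum_ite, Finset.sum_const_zero, add_zero, Finset.sum_const, nsmul_eq_mul, mul_one]
    have : (Finset.range (N - 1)).filter (fun i => k > i) = Finset.range k := by
      ext i
      simp only [Finset.mem_filter, Finset.mem_range]
      omega
    rw [this, Finset.card_range]
  rw [hcount, nsmul_eq_mul, hN1]
  field_simp
  ring

end Summit.AtomisticToContinuum.FouriersLaw.Cruxes.ConeScaleCorrector.IdeatorOne
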